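import Summits.ABC.IUTFork.Cor312ThetaSideClosedM
import Summits.ABC.IUTFork.Cor312ThetaLocalGeContentHull
import Literature.IUT.LogVolume.IntegerRingFinite
import HarnessLib

/-!
# [IUTchIII] Corollary 3.12 at the M-LEVEL sharp setting of the datum's OWN Θ-ideles — the local Θ-volume IS the orbit sum:
# `−|log(Θ)|_{i+1,u} = orbitSumM D r i u` (the «(or =)» half of the mint's TARGET #2 on the nonarchimedean side)

PROOF-ONLY file (D-0012; no definitions, no `Prop` facts) of the abc-iut cell (R2 S-chain seat abc-iut-s2-p9, gen 0; branch C
«abc ⇐ S»). TAKES NO SIDE on [IUTchIII] Cor. 3.12. The G1-Θ closer (abc-iut-s2-p8 p440655, on abc-iut-s2-p7's content-hull bound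
and abc-iut-w5-d166's identification) proves `thetaLocal ≤ orbitSumM` at every `(i+1, u)`; THIS file proves the REVERSE inequality,
hence EQUALITY, for the typed factorwise (Ind2) — by this seat's `Cor312Vol.sum_content_hull_le_thetaLocal_untopD` (the `ℤ`-span of
the factorwise orbit of one vector of exact content fills `p^m·log_p(R_I^×)`, Literature `TensorPacketFactorwiseOrbitSpan`), whose
two dischargers are met by the M-level signature: Ism IS the set of ALL bicontinuous shell-preserving automorphisms
(`exists_ism_presAtM_of_image_logUnits_eq`, Dupuy–Hilado §4.9 — every `ℚ_p`-linear lattice automorphism of `K_{v̲}` is continuous),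
and the (Ind3)-region IS the product of the last-slot Θ-boxes (`thetaRegion3_settingPrVolSharpM_eq_preimage_pi`), every slot box
being an (Ind1)-permutation image of a last-slot box (abc-iut-S8 `image_permAlgEquiv_iota_smul_normalizedPacket`).

* `orbitSumM_le_thetaLocal_settingPrVolSharpM_tOfIdeleData`, **`thetaLocal_settingPrVolSharpM_tOfIdeleData_eq_orbitSumM`**,
  **`thetaLocal_settingMSharp_tOfIdeleData_eq_orbitSumM`** (both routes).

So at the genuine carriers the M-setting's typed `−|log(Θ)|` is pinned summand-by-summand to Dupuy–Hilado's orbit sums: print's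
factorwise (Ind2) loses NOTHING against the full lattice group `Aut(I_{v⃗})` (the question (N1) of HOME/STATUS 11:18Z, answered).
[cite: Mochizuki2012, IUTchIII Thm. 3.11 (i) (Ind1), (Ind2) p. 154] [cite: Mochizuki2012, IUTchIV Thm. 1.10 Step (v) p. 27–28]
[cite: DupuyHilado2025, §4.7, §4.9, §4.12] [claim: Mochizuki2012, status: disputed] for the quoted setting.
HONEST FRAMING: identities between TYPED objects; nothing asserted or denied about Cor. 3.12; typed ≠ proved; instantiated ≠ endorsed.
-/

noncomputable section

open Set Function NumberField IsDedekindDomain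
open scoped Pointwise

namespace Summit.ABC.IUTFork.Thm311.Real

open Cor312 Cor312Vol Literature.IUT.LogThetaLattice Literature.IUT.LogVolume Literature.IUT.HodgeTheaters
  Literature.NumberTheory.NumberFields

variable {F K Fbar : Type} [Field F] [NumberField F] [Field K] [NumberField K] [Algebra F K]
  [Field Fbar] [Algebra F Fbar] [Algebra K Fbar] {E : WeierstrassCurve F} [E.IsElliptic] {l : ℕ}
  {Pb : BadPlacePredicates K} (D : InitialThetaData F K Fbar E l Pb) {logvK : PadicLogsVal K}
  (hlog : LogvAnalyticVal logvK) (r : ThetaData.IdeleData D)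
  (tq : ∀ (u : FinitePlace ℚ) (x : (thetaIndexOfInitial D).Fibre (Val.non u)),
    kOfM D (ratChar u) u (natCast_ratChar_mem u) x)
  (M : Type) [Field M] [NumberField M]
  (archPk : ∀ (j : (thetaIndexOfInitial D).Label) (vQ : (thetaIndexOfInitial D).VQ),
    Set ((logShellsOfInitialDH D logvK).Packet j vQ))
  (archSub : ∀ (j : (thetaIndexOfInitial D).Label) (v : (thetaIndexOfInitial D).V),
    Set ((logShellsOfInitialDH D logvK).Packet j ((thetaIndexOfInitial D).over v)))
  (Ψ : ℤ → ∀ v : (thetaIndexOfInitial D).V, v ∈ (thetaIndexOfInitial D).Vbad →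
    Set ((logShellsOfInitialDH D logvK).StarPacket v))
  (act : ℤ → ∀ v : (thetaIndexOfInitial D).V, v ∈ (thetaIndexOfInitial D).Vbad →
    (logShellsOfInitialDH D logvK).StarPacket v → Module.End ℚ ((logShellsOfInitialDH D logvK).StarPacket v))
  (Mmod : ℤ → ∀ j : (thetaIndexOfInitial D).LabelStar, Set ((logShellsOfInitialDH D logvK).GlobalPacket j.1))
  (region : ℤ → ∀ j : (thetaIndexOfInitial D).LabelStar, FinDivisor M → ∀ vQ : (thetaIndexOfInitial D).VQ,
    Set ((logShellsOfInitialDH D logvK).Packet j.1 vQ))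
  (n : ℤ) {HT : Type} {LogLink : HT → HT → Type} {IsFull : ∀ {s t : HT}, LogLink s t → Prop}
  (lat : LGPGaussianLogThetaLattice LogLink IsFull)
  {Frd : Type} {IsoF : Frd → Frd → Type} {Ob : Frd → Type} {realify : Frd → Frd} {Strip : Type}
  {IsoS : Strip → Strip → Type}
  {Mv : ∀ v : (thetaIndexOfInitial D).V, v ∈ (thetaIndexOfInitial D).Vbad → Type} [∀ v h, Monoid (Mv v h)]
  (sig : GlobalLGPFrobenioidSignature (thetaIndexOfInitial D).lstar (thetaIndexOfInitial D).V
    (· ∈ (thetaIndexOfInitial D).Vbad) Frd IsoF Ob realify Strip IsoS Mv)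
  (split : SplittingMonoids Mv) {ObΔ : Type}
  {N : ∀ v : (thetaIndexOfInitial D).V, v ∈ (thetaIndexOfInitial D).Vbad → Type} [∀ v h, Monoid (N v h)]
  (qData : QPilotData ObΔ N)
  (htq0 : ∀ u x, tq u x ≠ 0) (Sq : Finset (FinitePlace ℚ))
  (htq1 : ∀ (u : FinitePlace ℚ) (x : (thetaIndexOfInitial D).Fibre (Val.non u)), u ∉ Sq → ‖tq u x‖ = 1)

/-! ## §1. Ism of the M-level signature is FULL: every shell-preserving `ℚ_p`-linear automorphism of `K_{v̲}` is an Ism-element -/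

/-- **FULLNESS of Ism at the genuine carriers** (Dupuy–Hilado §4.9: `Aut_{ℚ_p}(K_{v̲} : I_{v̲})` = ALL lattice automorphisms): a
`ℚ_{p_u}`-linear automorphism `g'` of the presented field `K_{v̲}` (abc-iut-w5-d166's `presAtM`, `φ_{v̲} = id`) mapping `log_p(𝒪^×)`
onto itself is continuous with continuous inverse (finite dimension) and maps the shell `(p^*)⁻¹·log_p(𝒪^×)` onto itself, so it
IS (intertwined with) an element of the signature's Ism slot (c312-5 `LogShells.toDH_ism_of_isNon`). [cite: DupuyHilado2025, §4.9] -/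
theorem exists_ism_presAtM_of_image_logUnits_eq (u : FinitePlace ℚ) (x : (thetaIndexOfInitial D).Fibre (Val.non u))
    (g' : (presAtM D hlog u).k x ≃ₗ[ℚ_[ratChar u]] (presAtM D hlog u).k x)
    (hg' : g' '' Literature.IUT.LogVolume.logUnits ((presAtM D hlog u).k x) = Literature.IUT.LogVolume.logUnits ((presAtM D hlog u).k x)) :
    ∃ g ∈ (logShellsOfInitialDH D logvK).ism x.1, ∀ y, (presAtM D hlog u).φ x (g y) = g' ((presAtM D hlog u).φ x y) := by
  obtain ⟨⟨x1, hm⟩, hv⟩ := x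
  rcases x1 with w | w
  · exact absurd hv (over_arc_ne_non D u w hm)
  · haveI hfd : FiniteDimensional ℚ_[ratChar u] ((presAtM D hlog u).k ⟨⟨Sum.inr w, hm⟩, hv⟩) :=
      Literature.IUT.LogVolume.finiteDimensional (ratChar u) ((presAtM D hlog u).k ⟨⟨Sum.inr w, hm⟩, hv⟩)
    have hc : Continuous g' := by
      have h := g'.toContinuousLinearEquiv.continuous
      rwa [LinearEquiv.coe_toContinuousLinearEquiv'] at h
    have hc' : Continuous g'.symm := by
      have h := g'.toContinuousLinearEquiv.symm.continuous
      rwa [LinearEquiv.coe_toContinuousLinearEquiv_symm'] at h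
    -- the shell is `c • log_p(𝒪^×)` (`φ = id`)
    have hshell : (logShellsOfInitialDH D logvK).shell ⟨Sum.inr w, hm⟩ =
        (presAtM D hlog u).c • Literature.IUT.LogVolume.logUnits ((presAtM D hlog u).k ⟨⟨Sum.inr w, hm⟩, hv⟩) := by
      have h := (presAtM D hlog u).shell_eq ⟨⟨Sum.inr w, hm⟩, hv⟩
      rw [← h]
      ext a
      exact ⟨fun ha => ⟨a, ha, rfl⟩, fun ⟨b, hb, hba⟩ => hba ▸ hb⟩
    have himg : ∀ z : (presAtM D hlog u).k ⟨⟨Sum.inr w, hm⟩, hv⟩ ≃ₗ[ℚ_[ratChar u]] (presAtM D hlog u).k ⟨⟨Sum.inr w, hm⟩, hv⟩,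
        z '' Literature.IUT.LogVolume.logUnits ((presAtM D hlog u).k ⟨⟨Sum.inr w, hm⟩, hv⟩) =
          Literature.IUT.LogVolume.logUnits ((presAtM D hlog u).k ⟨⟨Sum.inr w, hm⟩, hv⟩) →
        z '' ((presAtM D hlog u).c • Literature.IUT.LogVolume.logUnits ((presAtM D hlog u).k ⟨⟨Sum.inr w, hm⟩, hv⟩)) =
          (presAtM D hlog u).c • Literature.IUT.LogVolume.logUnits ((presAtM D hlog u).k ⟨⟨Sum.inr w, hm⟩, hv⟩) := by
      intro z hz
      conv_rhs => rw [← hz]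
      rw [← Set.image_smul, ← Set.image_smul, Set.image_image, Set.image_image]
      exact Set.image_congr fun a _ => map_smul z _ a
    refine ⟨g'.restrictScalars ℚ, ?_, fun y => rfl⟩
    show g'.restrictScalars ℚ ∈ ((logShellsOfInitial₁ D logvK).toDH (topologyOfInitial D logvK)).ism ⟨Sum.inr w, hm⟩
    rw [LogShells.toDH_ism_of_isNon _ _ (isNon_over D u ⟨⟨Sum.inr w, hm⟩, hv⟩)]
    refine ⟨hc, hc', ?_⟩
    show g'.restrictScalars ℚ '' (logShellsOfInitialDH D logvK).shell ⟨Sum.inr w, hm⟩ =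
      (logShellsOfInitialDH D logvK).shell ⟨Sum.inr w, hm⟩
    rw [hshell]
    exact himg g' hg'

/-! ## §2. The (Ind3)-region of the sharp setting is the product of the last-slot boxes -/

/-- The (Ind3)-enlarged Θ-region of abc-iut-s2-p8's summand-route sharp setting at `(j, u)` IS `e⁻¹(Π_{v⃗} sharpBox_{v⃗})`
(abc-iut-s2-p8 `thetaRegion3_settingPrVolSharpM`, `thetaBoxM_non_eq`, `factorMap_preimage_boxOf`). [cite: DupuyHilado2025, §3.7] -/
theorem thetaRegion3_settingPrVolSharpM_eq_preimage_pi (t : ∀ (u : FinitePlace ℚ) (_ : Fin (thetaIndexOfInitial D).lstar)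
      (x : (thetaIndexOfInitial D).Fibre (Val.non u)), kOfM D (ratChar u) u (natCast_ratChar_mem u) x)
    (j : (thetaIndexOfInitial D).Label) (u : FinitePlace ℚ) :
    (settingPrVolSharpM D hlog t tq M archPk archSub Ψ act Mmod region n lat sig split qData htq0 Sq htq1).thetaRegion3 j
        (Val.non u) = (presAtM D hlog u).comparison j ⁻¹' Set.pi univ ((presAtM D hlog u).sharpBox (t u) j) := by
  rw [thetaRegion3_settingPrVolSharpM, thetaBoxM_non_eq]
  exact (presAtM D hlog u).factorMap_preimage_boxOf _

/-! ## §3. The reverse inequality and the equality at the datum's own Θ-ideles -/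

/-- The union of the possible images at `(i+1, u)` admits its hull (finiteness of the local term, abc-iut-s2-p8
`thetaFinite_settingPrVolSharpM` at the datum's own Θ-ideles). [claim: Mochizuki2012, status: disputed] -/
theorem hullDefined_settingPrVolSharpM_tOfIdeleData (i : Fin (thetaIndexOfInitial D).lstar) (u : FinitePlace ℚ) :
    (settingPrVolSharpM D hlog (tOfIdeleData D r) tq M archPk archSub Ψ act Mmod region n lat sig split qData htq0 Sq htq1).HullDefined (Setting.labelSucc i) (Val.non u) := by
  have hne : (settingPrVolSharpM D hlog (tOfIdeleData D r) tq M archPk archSub Ψ act Mmod region n lat sig split qData htq0 Sq htq1).thetaLocal (Setting.labelSucc i) (Val.non u) ≠ ⊤ :=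
    (thetaFinite_settingPrVolSharpM D hlog (tOfIdeleData D r) tq M archPk archSub Ψ act Mmod region n lat sig split qData htq0
      Sq htq1 (tOfIdeleData_ne_zero D r) _
      (fun u i x hu => norm_tThetaM_eq_one_of_not_mem_image D (ratChar u) u (natCast_ratChar_mem u) r i x hu)).1 i _
  by_contra h
  exact hne (by rw [Cor312.Setting.thetaLocal, if_neg h])

/-- **`hwit` at the datum's own Θ-ideles**: every summand `v⃗` at `(i+1, u)` carries, in the union of the possible images, a
vector of content EXACTLY `p_u^{m(v⃗)}` for abc-iut-s2-p7's content family `m` of the slot unions — the exact-content vector of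
the slot union lies in some slot `a`, i.e. in the (Ind1)-image `perm_σ(sharpBox_{v⃗∘σ})`, `σ = (last a)` (abc-iut-S8
`image_permAlgEquiv_iota_smul_normalizedPacket`), reached by `Cor312Vol.exists_mem_sUnion_possibleImages_comparison_eq_permX`.
[cite: Mochizuki2012, IUTchIII Thm. 3.11 (i) (Ind1) p. 154] [cite: DupuyHilado2025, §4.7, §4.12] -/
theorem exists_mem_sUnion_possibleImages_exact_content (i : Fin (thetaIndexOfInitial D).lstar) (u : FinitePlace ℚ)
    (m : ((thetaIndexOfInitial D).Caps (Setting.labelSucc i) → (thetaIndexOfInitial D).Fibre (Val.non u)) → ℤ)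
    (e : (thetaIndexOfInitial D).Caps (Setting.labelSucc i) → (thetaIndexOfInitial D).Fibre (Val.non u))
    (hm0 : (⋃ a, iota (ratChar u) ((presAtM D hlog u).kk e) a (tOfIdeleData D r u i (e a)) •
        (normalizedPacket (ratChar u) ((presAtM D hlog u).kk e) : Set ((presAtM D hlog u).X e))) ⊆
      (((ratChar u : ℕ) : ℚ_[ratChar u]) ^ m e) • (logPacket (ratChar u) ((presAtM D hlog u).kk e) : Set ((presAtM D hlog u).X e)))
    (hm1 : ¬ (⋃ a, iota (ratChar u) ((presAtM D hlog u).kk e) a (tOfIdeleData D r u i (e a)) •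
        (normalizedPacket (ratChar u) ((presAtM D hlog u).kk e) : Set ((presAtM D hlog u).X e))) ⊆
      (((ratChar u : ℕ) : ℚ_[ratChar u]) ^ (m e + 1)) •
        (logPacket (ratChar u) ((presAtM D hlog u).kk e) : Set ((presAtM D hlog u).X e))) :
    ∃ x ∈ ⋃₀ (settingPrVolSharpM D hlog (tOfIdeleData D r) tq M archPk archSub Ψ act Mmod region n lat sig split qData htq0 Sq htq1).possibleImages (Setting.labelSucc i) (Val.non u),
      (presAtM D hlog u).comparison (Setting.labelSucc i) x e ∈
          (((ratChar u : ℕ) : ℚ_[ratChar u]) ^ m e) •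
            (logPacket (ratChar u) ((presAtM D hlog u).kk e) : Set ((presAtM D hlog u).X e)) ∧
        (presAtM D hlog u).comparison (Setting.labelSucc i) x e ∉
          (((ratChar u : ℕ) : ℚ_[ratChar u]) ^ (m e + 1)) •
            (logPacket (ratChar u) ((presAtM D hlog u).kk e) : Set ((presAtM D hlog u).X e)) := by
  classical
  obtain ⟨y, hyU, hy1⟩ := Set.not_subset.mp hm1
  have hy0 := hm0 hyU
  obtain ⟨a, hya⟩ := Set.mem_iUnion.mp hyU
  obtain ⟨σ, rfl⟩ : ∃ σ : Equiv.Perm ((thetaIndexOfInitial D).Caps (Setting.labelSucc i)), σ (Fin.last _) = a :=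
    ⟨Equiv.swap (Fin.last _) a, Equiv.swap_apply_left _ _⟩
  -- the slot-`σ(last)` box at `v⃗` is `perm_σ` of the last-slot box at `v⃗∘σ`
  have hbox : ⇑(permAlgEquiv (ratChar u) ((presAtM D hlog u).kk e) σ) ''
      (presAtM D hlog u).sharpBox (tOfIdeleData D r u) (Setting.labelSucc i) (e ∘ σ) =
      iota (ratChar u) ((presAtM D hlog u).kk e) (σ (Fin.last _)) (tOfIdeleData D r u i (e (σ (Fin.last _)))) •
        (normalizedPacket (ratChar u) ((presAtM D hlog u).kk e) : Set ((presAtM D hlog u).X e)) := by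
    rw [PadicPresentation.sharpBox, PadicPresentation.labelIdele_labelSucc]
    exact image_permAlgEquiv_iota_smul_normalizedPacket (ratChar u) ((presAtM D hlog u).kk e) σ (Fin.last _) _
  rw [← hbox] at hya
  obtain ⟨z, hz, hzy⟩ := hya
  have hB0 : ∀ e', (0 : (presAtM D hlog u).X e') ∈ (presAtM D hlog u).sharpBox (tOfIdeleData D r u) (Setting.labelSucc i) e' :=
    fun e' => Set.mem_smul_set.mpr ⟨0, Subring.zero_mem _, smul_zero _⟩
  obtain ⟨x, hxU, hx⟩ := exists_mem_sUnion_possibleImages_comparison_eq_permX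
    (P := settingPrVolSharpM D hlog (tOfIdeleData D r) tq M archPk archSub Ψ act Mmod region n lat sig split qData htq0 Sq htq1)
    (presAtM D hlog u) (Setting.labelSucc i) ((presAtM D hlog u).sharpBox (tOfIdeleData D r u) (Setting.labelSucc i))
    (subset_of_eq (thetaRegion3_settingPrVolSharpM_eq_preimage_pi D hlog tq M archPk archSub Ψ act Mmod region n lat sig split
      qData htq0 Sq htq1 (tOfIdeleData D r) (Setting.labelSucc i) u).symm)
    hB0 e σ hz
  refine ⟨x, hxU, ?_⟩
  have hxy : (presAtM D hlog u).comparison (Setting.labelSucc i) x e = y := hx.trans hzy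
  rw [hxy]
  exact ⟨hy0, hy1⟩

/-- **`hism` at the M level**: every factorwise family of shell-preserving `ℚ_{p_u}`-linear automorphisms on a summand `v⃗` is
realised there by a member of the indeterminacy group of the M-level situation (§1 + this seat's
`Cor312Vol.exists_indGroup_comparison_eq_congr`). [cite: DupuyHilado2025, §4.9] [cite: Mochizuki2012, IUTchIII Thm. 3.11 (i) (Ind2) p. 154] -/
theorem exists_indGroup_comparison_eq_congr_presAtM (j : (thetaIndexOfInitial D).Label) (u : FinitePlace ℚ)
    (e : (thetaIndexOfInitial D).Caps j → (thetaIndexOfInitial D).Fibre (Val.non u))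
    (g' : ∀ a, (presAtM D hlog u).kk e a ≃ₗ[ℚ_[ratChar u]] (presAtM D hlog u).kk e a)
    (hg' : ∀ a, g' a '' Literature.IUT.LogVolume.logUnits ((presAtM D hlog u).kk e a) =
      Literature.IUT.LogVolume.logUnits ((presAtM D hlog u).kk e a)) :
    ∃ Φ ∈ Cor312.Setting.indGroup (situationPrVolM D hlog M archPk archSub Ψ act Mmod region), ∀ x,
      (presAtM D hlog u).comparison j (Φ j (Val.non u) x) e =
        (PiTensorProduct.congr g' : (presAtM D hlog u).X e ≃ₗ[ℚ_[ratChar u]] (presAtM D hlog u).X e)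
          ((presAtM D hlog u).comparison j x e) :=
  exists_indGroup_comparison_eq_congr (S := situationPrVolM D hlog M archPk archSub Ψ act Mmod region) (presAtM D hlog u) j
    (fun v g'' hg'' => exists_ism_presAtM_of_image_logUnits_eq D hlog u v g'' hg'') e g' hg'

/-- **`orbitSumM D r i u ≤ −|log(Θ)|_{i+1,u}`** at abc-iut-s2-p8's summand-route sharp setting of the datum's own Θ-ideles: this seat's
generic `Cor312Vol.sum_content_hull_le_thetaLocal_untopD` at abc-iut-s2-p7's exact content family of the slot unions
(`exists_symm_slotContentFamily_tThetaM`, BOTH halves), with `hism` from §1 (`Cor312Vol.exists_indGroup_comparison_eq_congr`), `hwit`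
from `exists_mem_sUnion_possibleImages_exact_content`, and the orbit-sum identity `sum_weightM_content_eq_orbitSumM`.
[cite: Mochizuki2012, IUTchIV Thm. 1.10 Step (v) p. 27–28] [cite: DupuyHilado2025, §4.9, §4.12] -/
theorem orbitSumM_le_thetaLocal_settingPrVolSharpM_tOfIdeleData (i : Fin (thetaIndexOfInitial D).lstar) (u : FinitePlace ℚ) :
    ((orbitSumM D r i u : ℝ) : WithTop ℝ) ≤ (settingPrVolSharpM D hlog (tOfIdeleData D r) tq M archPk archSub Ψ act Mmod region n lat sig split qData htq0 Sq htq1).thetaLocal (Setting.labelSucc i) (Val.non u) := by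
  classical
  letI : Fintype ((thetaIndexOfInitial D).Fibre (Val.non u)) := Fintype.ofFinite _
  letI : Fintype ((presAtM D hlog u).factorIdx (Setting.labelSucc i)) :=
    factorIdxM_fintype D hlog (Setting.labelSucc i) (Val.non u)
  have hne : (settingPrVolSharpM D hlog (tOfIdeleData D r) tq M archPk archSub Ψ act Mmod region n lat sig split qData htq0 Sq htq1).thetaLocal (Setting.labelSucc i) (Val.non u) ≠ ⊤ := by
    have h := hullDefined_settingPrVolSharpM_tOfIdeleData D hlog r tq M archPk archSub Ψ act Mmod region n lat sig split qData htq0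
      Sq htq1 i u
    rw [Cor312.Setting.thetaLocal, if_pos h]
    exact WithTop.coe_ne_top
  obtain ⟨m, -, hm⟩ := exists_symm_slotContentFamily_tThetaM D r i u
  have hge := sum_content_hull_le_thetaLocal_untopD
    (P := settingPrVolSharpM D hlog (tOfIdeleData D r) tq M archPk archSub Ψ act Mmod region n lat sig split qData htq0 Sq htq1)
    (presAtM D hlog u) i
    (hullDefined_settingPrVolSharpM_tOfIdeleData D hlog r tq M archPk archSub Ψ act Mmod region n lat sig split qData htq0 Sq htq1
      i u)
    (frame_settingPrVolSharpM_non D hlog (tOfIdeleData D r) tq M archPk archSub Ψ act Mmod region n lat sig split qData htq0 Sq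
      htq1 _ u)
    (fun R hR => logvol_situationPrVolM_preimage_pi D hlog M archPk archSub Ψ act Mmod region n _ u R hR) m
    (fun e => exists_mem_sUnion_possibleImages_exact_content D hlog r tq M archPk archSub Ψ act Mmod region n lat sig split qData
      htq0 Sq htq1 i u m e (hm e).1 (hm e).2)
    (fun e g' hg' => exists_indGroup_comparison_eq_congr_presAtM D hlog M archPk archSub Ψ act Mmod region
      (Setting.labelSucc i) u e g' hg')
  have hge' : orbitSumM D r i u ≤ ((settingPrVolSharpM D hlog (tOfIdeleData D r) tq M archPk archSub Ψ act Mmod region n lat sig split qData htq0 Sq htq1).thetaLocal (Setting.labelSucc i) (Val.non u)).untopD 0 :=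
    (le_of_eq (sum_weightM_content_eq_orbitSumM D r i u m hm).symm).trans hge
  obtain ⟨c, hc⟩ := WithTop.ne_top_iff_exists.mp hne
  rw [← hc] at hge' ⊢
  rw [WithTop.untopD_coe] at hge'
  exact WithTop.coe_le_coe.mpr hge'

/-- **THE LOCAL Θ-VOLUME IS THE ORBIT SUM — `−|log(Θ)|_{i+1,u} = orbitSumM D r i u`** at abc-iut-s2-p8's summand-route sharp
setting of the datum's own Θ-ideles (the closer's `≤`, p440655, and the reverse inequality above): print's factorwise (Ind2) and
Dupuy–Hilado's full lattice group give the SAME hull volume at every packet of the genuine carriers.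
[cite: Mochizuki2012, IUTchIV Thm. 1.10 Step (v) p. 27–28] [cite: DupuyHilado2025, §4.9, §4.12] -/
theorem thetaLocal_settingPrVolSharpM_tOfIdeleData_eq_orbitSumM (i : Fin (thetaIndexOfInitial D).lstar) (u : FinitePlace ℚ) :
    (settingPrVolSharpM D hlog (tOfIdeleData D r) tq M archPk archSub Ψ act Mmod region n lat sig split qData htq0 Sq
        htq1).thetaLocal (Setting.labelSucc i) (Val.non u) = ((orbitSumM D r i u : ℝ) : WithTop ℝ) := by
  refine le_antisymm ?_ (orbitSumM_le_thetaLocal_settingPrVolSharpM_tOfIdeleData D hlog r tq M archPk archSub Ψ act Mmod region n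
    lat sig split qData htq0 Sq htq1 i u)
  rw [← thetaLocal_settingMSharp_eq_settingPrVolSharpM]
  exact thetaLocal_settingMSharp_tOfIdeleData_le_orbitSumM D hlog r tq M archPk archSub Ψ act Mmod region n lat sig split qData
    htq0 Sq htq1 i u

/-- **… and at abc-iut-w5-d166's frames-route sharp setting `settingMSharp`** (same number, abc-iut-w4-d013's two-routes identity).
[cite: Mochizuki2012, IUTchIV Thm. 1.10 Step (v) p. 27–28] [cite: DupuyHilado2025, §4.9, §4.12] -/
theorem thetaLocal_settingMSharp_tOfIdeleData_eq_orbitSumM (i : Fin (thetaIndexOfInitial D).lstar) (u : FinitePlace ℚ) :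
    (settingMSharp D hlog M archPk archSub Ψ act Mmod region n lat sig split qData (tOfIdeleData D r) tq htq0 Sq htq1).thetaLocal
        (Setting.labelSucc i) (Val.non u) = ((orbitSumM D r i u : ℝ) : WithTop ℝ) := by
  rw [thetaLocal_settingMSharp_eq_settingPrVolSharpM]
  exact thetaLocal_settingPrVolSharpM_tOfIdeleData_eq_orbitSumM D hlog r tq M archPk archSub Ψ act Mmod region n lat sig split
    qData htq0 Sq htq1 i u

end Summit.ABC.IUTFork.Thm311.Real

end
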